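import Literature.Analysis.OperatorTheory.SlabFibreContraction
import HarnessLib

/-!
# Stub `stub_blockReversalTranspose` (R3) for the crux `WeakCouplingHypercubicLimit` (line `Sketch`)

**The contracted kernel of a REVERSED block observable is the transpose** (abstract measure theory, in the
shapes of `stub_slabContraction` / `Literature.Analysis.OperatorTheory.SlabFibreContraction`).  Setting: probability
spaces `(X, μ)` (slices) and `(Γ, ν)` (fibres), a one-step weight `c(x, γ, x')` with the TIME-REVERSAL symmetry
`c(x, ι γ, x') = c(x', γ, x)` for a measurable `ν`-preserving involution `ι : Γ → Γ`, a block observable `α` of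
`r + 2` consecutive slices and the `r + 1` fibres between them, and its reversal
`α'(W, γ⃗) = α(W ∘ rev, ι ∘ γ⃗ ∘ rev)`.  Claim: `X_{α'}(u, u') = X_α(u', u)` for the contracted block kernels
`X_α(u,u') = ∫∫ α(u ∷ v :: u', γ⃗) ∏ᵢ c((u ∷ v :: u')ᵢ, γᵢ, (u ∷ v :: u')ᵢ₊₁) dν^{⊗(r+1)} dμ^{⊗r}`.

Proof: `rev (u ∷ v :: u') = u' ∷ (v ∘ rev) :: u` pointwise; the weight reindexed by `i ↦ r − i` and the symmetry of
`c` turn the left integrand at `(v, γ⃗)` into the right integrand at `(v ∘ rev, ι ∘ γ⃗ ∘ rev)`; both substitutions are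
measure-preserving measurable equivalences of the finite product spaces (`MeasurableEquiv.arrowCongr'`,
`measurePreserving_arrowCongr'`, `integral_pi_comp_perm`), so the integrals agree
(`MeasurePreserving.integral_comp'`, no integrability needed).  This is the path-space form of Osterwalder–Seiler
reflection positivity ("the reflected slab operator is the adjoint"); cf. `integral_block_rev` in
`HeterogeneousCyclicPeeling` (the fibre-free case). [folklore]
-/

noncomputable section

open MeasureTheory Filter
open Literature.Analysis.OperatorTheory

namespace Summit.QuantumFields.YangMills.Theorems.WeakCouplingHypercubicLimit.TraceNormColdPressure

/-- Reversal of a block configuration: `(u ∷ v :: u') (rev j) = (u' ∷ (v ∘ rev) :: u) j`. [folklore] -/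
private theorem cons_snoc_rev_apply {Y : Type*} {r : ℕ} (u u' : Y) (v : Fin r → Y) (j : Fin (r + 2)) :
    (Fin.cons u (Fin.snoc v u') : Fin (r + 2) → Y) (Fin.rev j) =
      (Fin.cons u' (Fin.snoc (fun m => v (Fin.rev m)) u) : Fin (r + 2) → Y) j := by
  -- adapted from `integral_block_rev` (Literature/Analysis/OperatorTheory/HeterogeneousCyclicPeeling)
  refine Fin.cases ?_ (fun i => ?_) j
  · simp only [Fin.rev_zero, Fin.cons_zero]
    show (Fin.cons u (Fin.snoc v u') : Fin (r + 2) → Y) (Fin.last (r + 1)) = u'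
    rw [show (Fin.last (r + 1) : Fin (r + 2)) = (Fin.last r).succ from rfl, Fin.cons_succ, Fin.snoc_last]
  · simp only [Fin.cons_succ]
    refine Fin.lastCases ?_ (fun i' => ?_) i
    · simp only [Fin.snoc_last]
      rw [show Fin.rev (Fin.last r).succ = (0 : Fin (r + 2)) by ext; simp]
      simp only [Fin.cons_zero]
    · simp only [Fin.snoc_castSucc]
      rw [show Fin.rev (i'.castSucc.succ : Fin (r + 2)) = (Fin.rev i').castSucc.succ by
        ext; simp [Fin.val_rev]; omega]
      rw [Fin.cons_succ, Fin.snoc_castSucc]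

/-- Reindexing the one-step weights of a reversed block: with the symmetry `c(x, ι γ, x') = c(x', γ, x)`,
`∏ᵢ c(W(rev i.castSucc), ι(γ_{rev i}), W(rev i.succ)) = ∏ᵢ c(Wᵢ, γᵢ, Wᵢ₊₁)` (`rev ∘ castSucc = succ ∘ rev`,
`rev ∘ succ = castSucc ∘ rev`, and `∏` is invariant under `rev`). [folklore] -/
private theorem prod_weight_rev {X Γ : Type*} {c : X → Γ → X → ℝ} {ιΓ : Γ → Γ}
    (hcs : ∀ x γ x', c x (ιΓ γ) x' = c x' γ x) {r : ℕ} (W : Fin (r + 2) → X) (γs : Fin (r + 1) → Γ) :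
    ∏ i : Fin (r + 1), c (W (Fin.rev (Fin.castSucc i))) (ιΓ (γs (Fin.rev i))) (W (Fin.rev (Fin.succ i))) =
      ∏ i : Fin (r + 1), c (W (Fin.castSucc i)) (γs i) (W (Fin.succ i)) := by
  calc ∏ i : Fin (r + 1), c (W (Fin.rev (Fin.castSucc i))) (ιΓ (γs (Fin.rev i))) (W (Fin.rev (Fin.succ i)))
      = ∏ i : Fin (r + 1), (fun j => c (W (Fin.castSucc j)) (γs j) (W (Fin.succ j))) (Fin.revPerm i) := by
        refine Finset.prod_congr rfl fun i _ => ?_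
        rw [hcs, Fin.rev_castSucc, Fin.rev_succ, Fin.revPerm_apply]
    _ = ∏ i : Fin (r + 1), c (W (Fin.castSucc i)) (γs i) (W (Fin.succ i)) :=
        Equiv.prod_comp Fin.revPerm (fun j => c (W (Fin.castSucc j)) (γs j) (W (Fin.succ j)))

/-- The transpose identity `X_{α'}(u, u') = X_α(u', u)` in `Type*` generality; only the measurability, the
`ν`-invariance and the involutivity of `ι` and the symmetry of `c` are used (the two substitutions
`γ⃗ ↦ ι ∘ γ⃗ ∘ rev`, `v ↦ v ∘ rev` are measure-preserving measurable equivalences, so no integrability hypothesis is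
needed). [folklore] -/
theorem blockReversal_transpose {X Γ : Type*} [MeasurableSpace X] [MeasurableSpace Γ]
    {μ : Measure X} {ν : Measure Γ} [IsProbabilityMeasure μ] [IsProbabilityMeasure ν]
    {c : X → Γ → X → ℝ} {ιΓ : Γ → Γ} (hιm : Measurable ιΓ) (hιp : MeasurePreserving ιΓ ν ν)
    (hιi : ∀ γ, ιΓ (ιΓ γ) = γ) (hcs : ∀ x γ x', c x (ιΓ γ) x' = c x' γ x) {r : ℕ}
    (α : (Fin (r + 2) → X) → (Fin (r + 1) → Γ) → ℝ) (u u' : X) :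
    ∫ v : Fin r → X, ∫ γs : Fin (r + 1) → Γ,
        α (fun i => (Fin.cons u (Fin.snoc v u') : Fin (r + 2) → X) (Fin.rev i)) (fun i => ιΓ (γs (Fin.rev i))) *
          ∏ i : Fin (r + 1), c ((Fin.cons u (Fin.snoc v u') : Fin (r + 2) → X) (Fin.castSucc i)) (γs i)
            ((Fin.cons u (Fin.snoc v u') : Fin (r + 2) → X) (Fin.succ i)) ∂(Measure.pi fun _ => ν)
        ∂(Measure.pi fun _ => μ) =
      ∫ v : Fin r → X, ∫ γs : Fin (r + 1) → Γ, α (Fin.cons u' (Fin.snoc v u)) γs *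
          ∏ i : Fin (r + 1), c ((Fin.cons u' (Fin.snoc v u) : Fin (r + 2) → X) (Fin.castSucc i)) (γs i)
            ((Fin.cons u' (Fin.snoc v u) : Fin (r + 2) → X) (Fin.succ i)) ∂(Measure.pi fun _ => ν)
        ∂(Measure.pi fun _ => μ) := by
  -- the fibre reversal `γ⃗ ↦ ι ∘ γ⃗ ∘ rev` as a measure-preserving measurable equivalence
  let eι : Γ ≃ᵐ Γ :=
    { toFun := ιΓ, invFun := ιΓ, left_inv := hιi, right_inv := hιi,
      measurable_toFun := hιm, measurable_invFun := hιm }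
  let eΓ : (Fin (r + 1) → Γ) ≃ᵐ (Fin (r + 1) → Γ) := MeasurableEquiv.arrowCongr' Fin.revPerm eι
  have heΓ : ∀ (γs : Fin (r + 1) → Γ) (m : Fin (r + 1)), eΓ γs m = ιΓ (γs (Fin.rev m)) := fun _ _ => rfl
  have hpres : MeasurePreserving eΓ (Measure.pi fun _ => ν) (Measure.pi fun _ => ν) :=
    measurePreserving_arrowCongr' (fun _ => ν) (fun _ => ν) Fin.revPerm eι fun _ => hιp
  -- pointwise: the left integrand at `(v, γ⃗)` is the right integrand at `(v ∘ rev, eΓ γ⃗)`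
  have hpt : ∀ (v : Fin r → X) (γs : Fin (r + 1) → Γ),
      α (fun i => (Fin.cons u (Fin.snoc v u') : Fin (r + 2) → X) (Fin.rev i)) (fun i => ιΓ (γs (Fin.rev i))) *
          ∏ i : Fin (r + 1), c ((Fin.cons u (Fin.snoc v u') : Fin (r + 2) → X) (Fin.castSucc i)) (γs i)
            ((Fin.cons u (Fin.snoc v u') : Fin (r + 2) → X) (Fin.succ i)) =
        α (Fin.cons u' (Fin.snoc (fun m => v (Fin.rev m)) u)) (eΓ γs) *
          ∏ i : Fin (r + 1), c ((Fin.cons u' (Fin.snoc (fun m => v (Fin.rev m)) u) : Fin (r + 2) → X)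
            (Fin.castSucc i)) (eΓ γs i)
            ((Fin.cons u' (Fin.snoc (fun m => v (Fin.rev m)) u) : Fin (r + 2) → X) (Fin.succ i)) := by
    intro v γs
    have h1 : (fun i => (Fin.cons u (Fin.snoc v u') : Fin (r + 2) → X) (Fin.rev i)) =
        (Fin.cons u' (Fin.snoc (fun m => v (Fin.rev m)) u) : Fin (r + 2) → X) :=
      funext fun i => cons_snoc_rev_apply u u' v i
    have h2 : (fun i => ιΓ (γs (Fin.rev i))) = eΓ γs := rfl
    rw [h1, h2]
    congr 1
    rw [← prod_weight_rev hcs (Fin.cons u (Fin.snoc v u')) γs]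
    refine Finset.prod_congr rfl fun i _ => ?_
    rw [cons_snoc_rev_apply u u' v (Fin.castSucc i), cons_snoc_rev_apply u u' v (Fin.succ i), heΓ]
  calc ∫ v : Fin r → X, ∫ γs : Fin (r + 1) → Γ,
        α (fun i => (Fin.cons u (Fin.snoc v u') : Fin (r + 2) → X) (Fin.rev i)) (fun i => ιΓ (γs (Fin.rev i))) *
          ∏ i : Fin (r + 1), c ((Fin.cons u (Fin.snoc v u') : Fin (r + 2) → X) (Fin.castSucc i)) (γs i)
            ((Fin.cons u (Fin.snoc v u') : Fin (r + 2) → X) (Fin.succ i)) ∂(Measure.pi fun _ => ν)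
        ∂(Measure.pi fun _ => μ)
      = ∫ v : Fin r → X, ∫ γs : Fin (r + 1) → Γ,
          α (Fin.cons u' (Fin.snoc (fun m => v (Fin.rev m)) u)) (eΓ γs) *
            ∏ i : Fin (r + 1), c ((Fin.cons u' (Fin.snoc (fun m => v (Fin.rev m)) u) : Fin (r + 2) → X)
              (Fin.castSucc i)) (eΓ γs i)
              ((Fin.cons u' (Fin.snoc (fun m => v (Fin.rev m)) u) : Fin (r + 2) → X) (Fin.succ i))
          ∂(Measure.pi fun _ => ν) ∂(Measure.pi fun _ => μ) := by
        simp_rw [hpt]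
    _ = ∫ v : Fin r → X, ∫ γs : Fin (r + 1) → Γ,
          α (Fin.cons u' (Fin.snoc (fun m => v (Fin.rev m)) u)) γs *
            ∏ i : Fin (r + 1), c ((Fin.cons u' (Fin.snoc (fun m => v (Fin.rev m)) u) : Fin (r + 2) → X)
              (Fin.castSucc i)) (γs i)
              ((Fin.cons u' (Fin.snoc (fun m => v (Fin.rev m)) u) : Fin (r + 2) → X) (Fin.succ i))
          ∂(Measure.pi fun _ => ν) ∂(Measure.pi fun _ => μ) := by
        refine integral_congr_ae (Eventually.of_forall fun v => ?_)
        exact hpres.integral_comp' (fun γs : Fin (r + 1) → Γ =>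
          α (Fin.cons u' (Fin.snoc (fun m => v (Fin.rev m)) u)) γs *
            ∏ i : Fin (r + 1), c ((Fin.cons u' (Fin.snoc (fun m => v (Fin.rev m)) u) : Fin (r + 2) → X)
              (Fin.castSucc i)) (γs i)
              ((Fin.cons u' (Fin.snoc (fun m => v (Fin.rev m)) u) : Fin (r + 2) → X) (Fin.succ i)))
    _ = _ := integral_pi_comp_perm (ρ := μ) Fin.revPerm (fun v : Fin r → X => ∫ γs : Fin (r + 1) → Γ,
          α (Fin.cons u' (Fin.snoc v u)) γs *
            ∏ i : Fin (r + 1), c ((Fin.cons u' (Fin.snoc v u) : Fin (r + 2) → X) (Fin.castSucc i)) (γs i)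
              ((Fin.cons u' (Fin.snoc v u) : Fin (r + 2) → X) (Fin.succ i)) ∂(Measure.pi fun _ => ν))

/-- `stub_blockReversalTranspose` (R3, r8; ABSTRACT measure theory, the shapes of `stub_slabContraction`) — **the
contracted kernel of a REVERSED block observable is the transpose.**  Slices `(X, μ)`, fibres `(Γ, ν)` (probability
spaces), a bounded measurable one-step weight `c(x, γ, x')` with the TIME-REVERSAL symmetry `c(x, ι γ, x') = c(x', γ, x)`
for a measurable `ν`-preserving involution `ι : Γ → Γ` (in a lattice gauge theory: inversion of the temporal links); a bounded
measurable block observable `α` of `r+2` slices and `r+1` fibres, and its reversal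
`α'(W, γ⃗) = α(W ∘ rev, ι ∘ γ⃗ ∘ rev)`.  Then `X_{α'}(u, u') = X_α(u', u)` for the contracted block kernels
`X_α(u,u') = ∫∫ α(u ∷ v :: u', γ⃗) ∏ᵢ c((u ∷ v :: u')ᵢ, γᵢ, (u ∷ v :: u')ᵢ₊₁) dν^{⊗(r+1)} dμ^{⊗r}` (reverse the interior
slices and the fibres — measure-preserving — and reindex the weight `i ↦ r − i`).  This is the path-space form of
Osterwalder–Seiler reflection positivity: the reflected slab operator is the adjoint.  (The boundedness and joint
measurability hypotheses on `c` and `α` are part of the registered signature but not needed.) [folklore] -/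
theorem stub_blockReversalTranspose :
    ∀ (X Γ : Type) [MeasurableSpace X] [MeasurableSpace Γ] (μ : Measure X) (ν : Measure Γ)
      [IsProbabilityMeasure μ] [IsProbabilityMeasure ν] (c : X → Γ → X → ℝ) (Cc : ℝ) (ιΓ : Γ → Γ),
      Measurable (fun q : X × Γ × X => c q.1 q.2.1 q.2.2) → (∀ x γ x', 0 ≤ c x γ x' ∧ c x γ x' ≤ Cc) →
      Measurable ιΓ → MeasurePreserving ιΓ ν ν → (∀ γ, ιΓ (ιΓ γ) = γ) → (∀ x γ x', c x (ιΓ γ) x' = c x' γ x) →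
    ∀ (r : ℕ) (α : (Fin (r + 2) → X) → (Fin (r + 1) → Γ) → ℝ) (Cα : ℝ),
      Measurable (fun q : (Fin (r + 2) → X) × (Fin (r + 1) → Γ) => α q.1 q.2) → (∀ W γs, |α W γs| ≤ Cα) →
    ∀ u u' : X,
      (∫ v : Fin r → X, ∫ γs : Fin (r + 1) → Γ,
          (fun (W : Fin (r + 2) → X) (δs : Fin (r + 1) → Γ) => α (fun i => W (Fin.rev i)) (fun i => ιΓ (δs (Fin.rev i))))
            (Fin.cons u (Fin.snoc v u')) γs *
          ∏ i : Fin (r + 1), c ((Fin.cons u (Fin.snoc v u') : Fin (r + 2) → X) (Fin.castSucc i)) (γs i)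
            ((Fin.cons u (Fin.snoc v u') : Fin (r + 2) → X) (Fin.succ i)) ∂(Measure.pi fun _ => ν) ∂(Measure.pi fun _ => μ)) =
      ∫ v : Fin r → X, ∫ γs : Fin (r + 1) → Γ, α (Fin.cons u' (Fin.snoc v u)) γs *
          ∏ i : Fin (r + 1), c ((Fin.cons u' (Fin.snoc v u) : Fin (r + 2) → X) (Fin.castSucc i)) (γs i)
            ((Fin.cons u' (Fin.snoc v u) : Fin (r + 2) → X) (Fin.succ i)) ∂(Measure.pi fun _ => ν) ∂(Measure.pi fun _ => μ) := by
  intro X Γ _ _ μ ν _ _ c _ ιΓ _ _ hιm hιp hιi hcs r α _ _ _ u u'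
  exact blockReversal_transpose hιm hιp hιi hcs α u u'

end Summit.QuantumFields.YangMills.Theorems.WeakCouplingHypercubicLimit.TraceNormColdPressure

end
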